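import Literature.Probability.LatticeModels.DiluteLoopModelSAW

/-!
# Locality and additivity of the closed-strand count `loops` — helper file 3/5 of stub
`stub_determinantal` of line `symplectic-fermion-anchor` (crux `SAWLoopFugacityFlow.AvoidanceLimit`,
stmt-CriticalPhenomena-10649)

The number `loops Λ F ∅` of closed strands of the tree's `DiluteLoopModel` (connected components of
the strand graph on half-edges all of whose half-edges are matched) only sees the volume through the
present half-edges (`loops_congr_vol`) and is ADDITIVE over vertex-disjoint unions of edge sets
(`loops_union`): the strand graph of `F₁ ∪ F₂` is the disjoint union of the two strand graphs, so
reachability, matchedness and the closed components split. Folklore; no definitions.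
-/

noncomputable section

open scoped BigOperators Topology symmDiff
open Filter Finset
open Literature.Probability.LatticeModels

namespace Summit.CriticalPhenomena.SAWScalingLimit.Theorems.AvoidanceLimit.Anchor

namespace DetExpansion

/-! ## Closed strands: locality and additivity of `loops` -/

section Loops

open DiluteLoopModel SimpleGraph

/-- Two maps that induce the same equivalence relation on `s` have images of the same size. [folklore] -/
theorem card_image_eq_of_iff {α β γ : Type*} [DecidableEq β] [DecidableEq γ] (s : Finset α) (f : α → β)
    (g : α → γ) (h : ∀ x ∈ s, ∀ y ∈ s, f x = f y ↔ g x = g y) : #(s.image f) = #(s.image g) := by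
  classical
  induction s using Finset.induction_on with
  | empty => simp
  | insert a s ha ih =>
    rw [image_insert, image_insert]
    have ih' := ih fun x hx y hy => h x (mem_insert_of_mem hx) y (mem_insert_of_mem hy)
    by_cases hfa : f a ∈ s.image f
    · obtain ⟨y, hy, hfy⟩ := mem_image.1 hfa
      have hga : g a ∈ s.image g :=
        mem_image.2 ⟨y, hy, ((h y (mem_insert_of_mem hy) a (mem_insert_self a s)).1 hfy)⟩
      rw [insert_eq_of_mem hfa, insert_eq_of_mem hga, ih']
    · have hga : g a ∉ s.image g := fun hga => by
        obtain ⟨y, hy, hgy⟩ := mem_image.1 hga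
        exact hfa (mem_image.2 ⟨y, hy, (h y (mem_insert_of_mem hy) a (mem_insert_self a s)).2 hgy⟩)
      rw [card_insert_of_notMem hfa, card_insert_of_notMem hga, ih']

variable {F F₁ F₂ : Finset (Sym2 (Site 2))} {S : Finset (Site 2)}

/-- **`loops` only sees the volume through the present half-edges**: two volumes containing the
same endpoints of `F` count the same closed strands. [folklore] -/
theorem loops_congr_vol {Λ Λ' : Finset (Site 2)}
    (h : ∀ y : Site 2 × Dir, hedge y ∈ F → (y.1 ∈ Λ ↔ y.1 ∈ Λ')) : loops Λ F S = loops Λ' F S := by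
  have hd : darts Λ F = darts Λ' F := by
    ext y
    simp only [mem_darts]
    exact ⟨fun hy => ⟨(h y hy.2).1 hy.1, hy.2⟩, fun hy => ⟨(h y hy.2).2 hy.1, hy.2⟩⟩
  unfold loops
  rw [hd]

/-- Both ends of a generating pair of the strand graph are present half-edges. [folklore] -/
theorem hedge_mem_of_strandRel {y y' : Site 2 × Dir} (h : strandRel F S y y') :
    hedge y ∈ F ∧ hedge y' ∈ F := by
  refine ⟨h.1, ?_⟩
  rcases h.2 with rfl | ⟨h1, hp⟩
  · rw [hedge_flip]; exact h.1
  · have : y' = (y.1, y'.2) := Prod.ext h1 rfl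
    rw [this]; exact hp.2.2.1

/-- Adjacent half-edges of the strand graph are present. [folklore] -/
theorem hedge_mem_of_adj {y y' : Site 2 × Dir} (h : (strandGraph F S).Adj y y') :
    hedge y ∈ F ∧ hedge y' ∈ F := by
  rcases (strandGraph_adj.1 h).2 with hr | hr
  · exact hedge_mem_of_strandRel hr
  · exact (hedge_mem_of_strandRel hr).symm

/-- The base vertex of a half-edge lies on its edge. [folklore] -/
theorem fst_mem_hedge (y : Site 2 × Dir) : y.1 ∈ hedge y := Sym2.mem_mk_left _ _

section Union

variable (hdj : ∀ z : Site 2, ∀ e₁ ∈ F₁, ∀ e₂ ∈ F₂, z ∈ e₁ → z ∉ e₂)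
include hdj

/-- Vertex-disjointness is symmetric. [folklore] -/
theorem vdj_symm : ∀ z : Site 2, ∀ e₂ ∈ F₂, ∀ e₁ ∈ F₁, z ∈ e₂ → z ∉ e₁ :=
  fun z e₂ he₂ e₁ he₁ hz₂ hz₁ => hdj z e₁ he₁ e₂ he₂ hz₁ hz₂

/-- Vertex-disjoint edge sets are disjoint. [folklore] -/
theorem vdj_disjoint : Disjoint F₁ F₂ := by
  rw [Finset.disjoint_left]
  intro e he₁ he₂
  induction e using Sym2.ind with
  | _ a b => exact hdj a _ he₁ _ he₂ (Sym2.mem_mk_left a b) (Sym2.mem_mk_left a b)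

/-- At a vertex of `F₁`, every half-edge of `F₁ ∪ F₂` belongs to `F₁`. [folklore] -/
theorem vdj_hedge_mem_left {z : Site 2} {d d' : Dir} (hd : hedge (z, d) ∈ F₁)
    (hd' : hedge (z, d') ∈ F₁ ∪ F₂) : hedge (z, d') ∈ F₁ := by
  rcases mem_union.1 hd' with h | h
  · exact h
  · exact absurd (fst_mem_hedge (z, d')) (hdj z _ hd _ h (fst_mem_hedge (z, d)))

/-- At a vertex of `F₁`, the lattice degree of `F₁ ∪ F₂` is that of `F₁`. [folklore] -/
theorem vdj_ldeg_union_left {z : Site 2} {d : Dir} (hd : hedge (z, d) ∈ F₁) :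
    ldeg (F₁ ∪ F₂) z = ldeg F₁ z := by
  unfold ldeg
  congr 1
  ext d'
  simp only [mem_filter, mem_univ, true_and]
  exact ⟨(vdj_hedge_mem_left hdj) hd, fun h => mem_union_left _ h⟩

/-- At a vertex of `F₁`, the pairing rule of `F₁ ∪ F₂` is that of `F₁`. [folklore] -/
theorem vdj_isPaired_union_left_iff {z : Site 2} {d d' : Dir} (hd : hedge (z, d) ∈ F₁) :
    IsPaired (F₁ ∪ F₂) S z d d' ↔ IsPaired F₁ S z d d' := by
  unfold IsPaired
  rw [(vdj_ldeg_union_left hdj) hd]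
  exact ⟨fun h => ⟨h.1, hd, (vdj_hedge_mem_left hdj) hd h.2.2.1, h.2.2.2⟩,
    fun h => ⟨h.1, mem_union_left _ hd, mem_union_left _ h.2.2.1, h.2.2.2⟩⟩

/-- At a half-edge of `F₁`, the generating relation of the strand graph of `F₁ ∪ F₂` is that of `F₁`.
[folklore] -/
theorem vdj_strandRel_union_left_iff {y y' : Site 2 × Dir} (hy : hedge y ∈ F₁) :
    strandRel (F₁ ∪ F₂) S y y' ↔ strandRel F₁ S y y' := by
  unfold strandRel
  have hy' : hedge (y.1, y.2) ∈ F₁ := hy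
  rw [(vdj_isPaired_union_left_iff hdj) hy']
  exact ⟨fun h => ⟨hy, h.2⟩, fun h => ⟨mem_union_left _ hy, h.2⟩⟩

/-- A strand-graph neighbour (in `F₁ ∪ F₂`) of a half-edge of `F₁` is a half-edge of `F₁`. [folklore] -/
theorem vdj_hedge_mem_left_of_adj {y y' : Site 2 × Dir} (hy : hedge y ∈ F₁)
    (h : (strandGraph (F₁ ∪ F₂) S).Adj y y') : hedge y' ∈ F₁ := by
  have hy'F : hedge y' ∈ F₁ ∪ F₂ := (hedge_mem_of_adj h).2
  rcases (strandGraph_adj.1 h).2 with hr | hr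
  · rcases hr.2 with rfl | ⟨h1, -⟩
    · rwa [hedge_flip]
    · have : y' = (y.1, y'.2) := Prod.ext h1 rfl
      rw [this] at hy'F ⊢
      exact vdj_hedge_mem_left hdj (d := y.2) hy hy'F
  · rcases hr.2 with rfl | ⟨h1, -⟩
    · rwa [← hedge_flip]
    · have : y' = (y.1, y'.2) := Prod.ext h1.symm rfl
      rw [this] at hy'F ⊢
      exact vdj_hedge_mem_left hdj (d := y.2) hy hy'F

/-- At a half-edge of `F₁`, adjacency in the strand graph of `F₁ ∪ F₂` is adjacency for `F₁`. [folklore] -/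
theorem vdj_adj_union_left_iff {y y' : Site 2 × Dir} (hy : hedge y ∈ F₁) :
    (strandGraph (F₁ ∪ F₂) S).Adj y y' ↔ (strandGraph F₁ S).Adj y y' := by
  constructor
  · intro h
    have hy' := (vdj_hedge_mem_left_of_adj hdj) hy h
    rw [strandGraph_adj] at h ⊢
    exact ⟨h.1, h.2.imp ((vdj_strandRel_union_left_iff hdj) hy).1 ((vdj_strandRel_union_left_iff hdj) hy').1⟩
  · intro h
    have hy' := (hedge_mem_of_adj h).2
    rw [strandGraph_adj] at h ⊢
    exact ⟨h.1, h.2.imp ((vdj_strandRel_union_left_iff hdj) hy).2 ((vdj_strandRel_union_left_iff hdj) hy').2⟩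

/-- The strand graph of `F₁` is a subgraph of that of `F₁ ∪ F₂`. [folklore] -/
theorem vdj_strandGraph_le_left : strandGraph F₁ S ≤ strandGraph (F₁ ∪ F₂) S :=
  fun _ _ h => ((vdj_adj_union_left_iff hdj) (hedge_mem_of_adj h).1).2 h

/-- Reachability from a half-edge of `F₁` in the strand graph of `F₁ ∪ F₂` stays inside `F₁` and is
reachability for `F₁`. [folklore] -/
theorem vdj_reachable_union_left {y y' : Site 2 × Dir} (hy : hedge y ∈ F₁)
    (h : (strandGraph (F₁ ∪ F₂) S).Reachable y y') :
    hedge y' ∈ F₁ ∧ (strandGraph F₁ S).Reachable y y' := by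
  obtain ⟨w⟩ := h
  induction w with
  | nil => exact ⟨hy, Reachable.refl _⟩
  | cons hadj w ih =>
    have h₁ := (vdj_hedge_mem_left_of_adj hdj) hy hadj
    obtain ⟨h₂, h₃⟩ := ih h₁
    exact ⟨h₂, (((vdj_adj_union_left_iff hdj) hy).1 hadj).reachable.trans h₃⟩

/-- At a half-edge of `F₁`, matchedness for `F₁ ∪ F₂` is matchedness for `F₁`. [folklore] -/
theorem vdj_isMatched_union_left_iff {y : Site 2 × Dir} (hy : hedge y ∈ F₁) :
    IsMatched (F₁ ∪ F₂) S y ↔ IsMatched F₁ S y :=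
  exists_congr fun _ => vdj_isPaired_union_left_iff hdj (d := y.2) hy

/-- A half-edge of `F₁` starts a closed strand of `F₁ ∪ F₂` iff it starts one of `F₁`. [folklore] -/
theorem vdj_good_union_left_iff {Λ : Finset (Site 2)} {y : Site 2 × Dir} (hy : hedge y ∈ F₁) :
    (∀ y' ∈ darts Λ (F₁ ∪ F₂),
        (strandGraph (F₁ ∪ F₂) S).Reachable y y' → IsMatched (F₁ ∪ F₂) S y') ↔
      ∀ y' ∈ darts Λ F₁, (strandGraph F₁ S).Reachable y y' → IsMatched F₁ S y' := by
  constructor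
  · intro h y' hy' hr
    rw [mem_darts] at hy'
    exact ((vdj_isMatched_union_left_iff hdj) hy'.2).1
      (h y' (mem_darts.2 ⟨hy'.1, mem_union_left _ hy'.2⟩) (hr.mono (vdj_strandGraph_le_left hdj)))
  · intro h y' hy' hr
    obtain ⟨h₁, h₂⟩ := (vdj_reachable_union_left hdj) hy hr
    exact ((vdj_isMatched_union_left_iff hdj) h₁).2 (h y' (mem_darts.2 ⟨(mem_darts.1 hy').1, h₁⟩) h₂)

omit hdj in
/-- **Additivity of `loops` over vertex-disjoint unions** (trivial resolution). [folklore] -/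
theorem loops_union (hdj : ∀ z : Site 2, ∀ e₁ ∈ F₁, ∀ e₂ ∈ F₂, z ∈ e₁ → z ∉ e₂)
    (Λ : Finset (Site 2)) :
    loops Λ (F₁ ∪ F₂) ∅ = loops Λ F₁ ∅ + loops Λ F₂ ∅ := by
  classical
  -- the closed-strand half-edges split
  set P : Finset (Sym2 (Site 2)) → (Site 2 × Dir) → Prop := fun F y =>
    ∀ y' ∈ darts Λ F, (strandGraph F ∅).Reachable y y' → IsMatched F ∅ y' with hP
  have hsplit : (darts Λ (F₁ ∪ F₂)).filter (P (F₁ ∪ F₂)) =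
      (darts Λ F₁).filter (P F₁) ∪ (darts Λ F₂).filter (P F₂) := by
    ext y
    simp only [mem_filter, mem_union, hP]
    constructor
    · rintro ⟨hyd, hgood⟩
      have hyd' := mem_darts.1 hyd
      rcases mem_union.1 hyd'.2 with hyF | hyF
      · exact Or.inl ⟨mem_darts.2 ⟨hyd'.1, hyF⟩, ((vdj_good_union_left_iff hdj) hyF).1 hgood⟩
      · refine Or.inr ⟨mem_darts.2 ⟨hyd'.1, hyF⟩, ((vdj_good_union_left_iff (vdj_symm hdj)) hyF).1 ?_⟩
        rwa [union_comm]
    · rintro (⟨hyd, hgood⟩ | ⟨hyd, hgood⟩)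
      · have hyd' := mem_darts.1 hyd
        exact ⟨mem_darts.2 ⟨hyd'.1, mem_union_left _ hyd'.2⟩, ((vdj_good_union_left_iff hdj) hyd'.2).2 hgood⟩
      · have hyd' := mem_darts.1 hyd
        refine ⟨mem_darts.2 ⟨hyd'.1, mem_union_right _ hyd'.2⟩, ?_⟩
        have := (vdj_good_union_left_iff (vdj_symm hdj) (Λ := Λ) (S := ∅) hyd'.2).2 hgood
        rwa [union_comm] at this
  have hdisj : Disjoint (((darts Λ F₁).filter (P F₁)).image (strandGraph (F₁ ∪ F₂) ∅).connectedComponentMk)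
      (((darts Λ F₂).filter (P F₂)).image (strandGraph (F₁ ∪ F₂) ∅).connectedComponentMk) := by
    rw [Finset.disjoint_left]
    intro c hc₁ hc₂
    obtain ⟨y₁, hy₁, rfl⟩ := mem_image.1 hc₁
    obtain ⟨y₂, hy₂, hc⟩ := mem_image.1 hc₂
    have hy₁F : hedge y₁ ∈ F₁ := (mem_darts.1 (mem_filter.1 hy₁).1).2
    have hy₂F : hedge y₂ ∈ F₂ := (mem_darts.1 (mem_filter.1 hy₂).1).2
    have hr : (strandGraph (F₁ ∪ F₂) ∅).Reachable y₁ y₂ := ConnectedComponent.eq.1 hc.symm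
    have := ((vdj_reachable_union_left hdj) hy₁F hr).1
    exact hdj _ _ this _ hy₂F (fst_mem_hedge y₂) (fst_mem_hedge y₂)
  have h1 : #(((darts Λ F₁).filter (P F₁)).image (strandGraph (F₁ ∪ F₂) ∅).connectedComponentMk) =
      #(((darts Λ F₁).filter (P F₁)).image (strandGraph F₁ ∅).connectedComponentMk) := by
    refine card_image_eq_of_iff _ _ _ fun y hy y' _ => ?_
    rw [ConnectedComponent.eq, ConnectedComponent.eq]
    have hyF : hedge y ∈ F₁ := (mem_darts.1 (mem_filter.1 hy).1).2
    exact ⟨fun h => ((vdj_reachable_union_left hdj) hyF h).2, fun h => h.mono (vdj_strandGraph_le_left hdj)⟩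
  have h2 : #(((darts Λ F₂).filter (P F₂)).image (strandGraph (F₁ ∪ F₂) ∅).connectedComponentMk) =
      #(((darts Λ F₂).filter (P F₂)).image (strandGraph F₂ ∅).connectedComponentMk) := by
    refine card_image_eq_of_iff _ _ _ fun y hy y' _ => ?_
    rw [ConnectedComponent.eq, ConnectedComponent.eq]
    have hyF : hedge y ∈ F₂ := (mem_darts.1 (mem_filter.1 hy).1).2
    rw [union_comm]
    exact ⟨fun h => ((vdj_reachable_union_left (vdj_symm hdj)) hyF h).2,
      fun h => h.mono (vdj_strandGraph_le_left (vdj_symm hdj))⟩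
  have key : #(((darts Λ (F₁ ∪ F₂)).filter (P (F₁ ∪ F₂))).image
      (strandGraph (F₁ ∪ F₂) ∅).connectedComponentMk) =
      #(((darts Λ F₁).filter (P F₁)).image (strandGraph F₁ ∅).connectedComponentMk) +
        #(((darts Λ F₂).filter (P F₂)).image (strandGraph F₂ ∅).connectedComponentMk) := by
    rw [hsplit, image_union, card_union_of_disjoint hdisj, h1, h2]
  unfold loops
  convert key using 2

end Union

end Loops

end DetExpansion

/-- Registered sub-goal of this helper file (stub `stub_determinantal`, file 3/5): **additivity of the
closed-strand count over vertex-disjoint unions**. [folklore] -/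
theorem loops_union_of_vertexDisjoint :
    ∀ (Λ : Finset (Site 2)) (F₁ F₂ : Finset (Sym2 (Site 2))),
      (∀ z : Site 2, ∀ e₁ ∈ F₁, ∀ e₂ ∈ F₂, z ∈ e₁ → z ∉ e₂) →
        DiluteLoopModel.loops Λ (F₁ ∪ F₂) ∅ =
          DiluteLoopModel.loops Λ F₁ ∅ + DiluteLoopModel.loops Λ F₂ ∅ :=
  fun Λ _ _ hdj => DetExpansion.loops_union hdj Λ

end Summit.CriticalPhenomena.SAWScalingLimit.Theorems.AvoidanceLimit.Anchor

end
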